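import Summits.QuantumFields.YangMills.Theorems.BalabanUVNodesN15KingModelGraphTreeDecayContinuumKernel

/-!
# BalabanUVNodes ∕ N15 — THE KING-MODEL RUNG (PART Β-h): THE CONTINUUM n-POINT KERNEL OF A DIAGRAM EXISTS AND CLUSTERS EXPONENTIALLY IN EVERY PAIR OF ITS ARGUMENTS —
# THEOREM 2.1 (i)'s SHAPE «∃ lim_{κ→∞}» FOR `E^{(K)}(G; {y_{b_υ}})` WITH ANY FINITE FAMILY OF KING's EXTERNAL LINES AT FIXED UNIT SITES, WITH (3.56)'s RATE AND PAIR DECAY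
# AGAINST THE LIMIT AND (3.38)∕(3.6)'s DECAY SHAPE OF THE LIMIT, BY NAME AT `A = 0` (the n-legged edition of part Β-e)
# (Track A, DAG node N15 = NE2; FAN-OUT v1.1 §N15 s3 «KING-MODEL RUNG … NE2's analogue DECIDED in the model»)

HONEST FRAMING.  Count-neutral (cell `pub-ymgap`, seat `pub-ymgap-dag-n15-e` g30; `--supports stmt-QuantumFields-27366 --as helper` = K3⁸
`SpineGivenEndpointR13SepCoPHV`).  TEMPLATE LITERATURE: C. King, *The U(1) Higgs model. I. The continuum limit*, Commun. Math. Phys. **102** (1986) 649–677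
[King1986]: Theorem 2.1 (i) (2.22) p. 654 with (3.13) p. 657, Proposition 3.6 (3.56) p. 662 and Theorem 3.5 (3.38) p. 660 (tree decay `exp[−δ d({y_i})]`, read here
PAIRWISE: `d({y_i}) ≥ |y_i − y_j|`), Proposition 3.8 (3.71) p. 664 — run on ONE DIAGRAM of KING's OWN `A = 0` MODEL at fixed volume `2L^{e_M}` with ANY finite family `Υ`
of King's external lines to fixed unit sites.  NOT `Z`, NOT Bałaban's `G(U)`, NOT a node discharge; «continuum» = King's `κ → ∞` at fixed torus; nothing continuum-ℝ⁴ ∕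
OS ∕ mass-gap ∕ Clay.  0 `sorry`; standard axioms.  Pages re-read 2026-08-29.

THE PRINT.  p. 654 [PDF 6] (2.22): *«∃ lim_{κ→∞} Z^{ε_κ}(T_{ε_κ}, g, h)»*; p. 662 [PDF 14] (3.56): *«… L^{−γk} exp[−δ d({y_i}, {z_q}, {w_l})]»*; p. 660 [PDF 12]: *«dist({u_i}) … the
length of the shortest tree graph connecting {u_i}»*, (3.38): *«|E^{(θ)}(H, …)| ≤ C … exp[−δ dist({y_i}, {z_j})]»*.

READING (declared; ours).  `kingLegSeq Υ vtx b κe K := E^{(K+1)}(G; {y_{b_υ}})` — the connected graph with King's (3.71) legs from `vtx υ` to the unit sites `b_υ`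
(kinds `κe υ`), `K + 1` coarse scales.  By part Β-e's transport the `(K+2)`-term's legs are the fine legs at `(jvSucc e_M K, n = 1)`, so part Α-g's
`king_prop36_extLegs_treeDecay_collected` bounds the consecutive difference by `e^{−δ·treeLength}·L^{−γ(K+1)}·A^{2m+nn+|Υ|}m!(m+|Υ|+1)`; the tree decay dominates the
decay in ANY PAIR of anchored points (part Α-f `exp_treeLength_le_exp_pair`), and base points are `≥ |b − b′|_T − 1` apart ⇒ geometric consecutive differences
`C_{υ₁υ₂}·(L^{−γ})^K` with `C_{υ₁υ₂} = (e^{δ}A^{…}…)·L^{−γ}·e^{−δ|b_{υ₁}−b_{υ₂}|_T}` for every pair; likewise part Α-l's size `_subgraphs` gives `|E^{(K+1)}| ≤ S_G Q^{|Υ|−1}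
e^{δ′}e^{−δ′|b_{υ₁}−b_{υ₂}|_T}` uniformly in `K`.  Hence ★★★ ONE limit `E^{(∞)}(G; {b_υ})` with, FOR EVERY PAIR, `|E^{(K+1)} − E^{(∞)}| ≤ C_{υ₁υ₂}(L^{−γ})^K∕(1−L^{−γ})`, and
★★★ `|E^{(∞)}| ≤ S_G Q^{|Υ|−1}e^{δ′}e^{−δ′|b_{υ₁}−b_{υ₂}|_T}` (exponential clustering in every pair).  §3: NO hypothesis for connected pseudoforests of `G`-lines in `1 ≤ d ≤ 3`.

WHAT THIS FILE PROVES (namespace `Summit.QuantumFields.YangMills.BalabanUVNodes.N15KingModelRung.Curved`).  §1 `kingLegSeq`, ★ `kingLegSeq_succ_sub_le` (every pair),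
★ `kingLegSeq_abs_le` (every pair).  §2 ★★★ **`king_graphLegs_continuumLimit`**, ★★★ **`king_graphLegs_limit_pairDecay`**.  §3 ★★ `king_pseudoforestLegs_continuumLimit`,
★★ `king_pseudoforestLegs_limit_pairDecay`.

HONEST SCOPE.  (a) Pairwise decay only: the K-uniform TREE-decay reading of the limit would need a Steiner comparison between `treeLength` on `T_η` and on `T^{(K)}`
(not typed); one diagram of King's `A = 0` model at fixed torus; legs = the two kernel members of (3.71); p. 664's sentence is the hypothesis of §2; §3.5 not typed.
(b) NOT Bałaban's `G(U)`; N15 untouched; counts unmoved.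
Locators: [King1986] Thm 2.1 (i) (2.22) p.654, (3.13) p.657, Thm 3.5 (3.38) p.660, p.660 (dist), Prop. 3.6 (3.56) p.662, p.664, Prop. 3.8 (3.71) p.664.
-/

noncomputable section

open scoped BigOperators Topology
open Finset Filter

namespace Summit.QuantumFields.YangMills.BalabanUVNodes.N15KingModelRung.Curved

open Literature.MathematicalPhysics.QuantumFieldTheory.Balaban1983to89.B5Prop11Plancherel (Tor fine)
open Literature.MathematicalPhysics.QuantumFieldTheory.King1986.Torus (tdistT tdistT_nonneg)
open Summit.QuantumFields.YangMills.BalabanUVNodes.N15KingModelRung (KingVolIndex kingVol kingVol_neZero basePt blockOf_basePt)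
open Summit.QuantumFields.YangMills.BalabanUVNodes.N15KingModelRung.Graph

variable {d : ℕ} (L : ℕ) [NeZero L]

/-! ## §1 The n-point kernel along `K`: geometric consecutive differences and a uniform size, with decay in every pair -/

section Objects

/-- **THE n-POINT KERNEL ALONG `K`**: `kingLegSeq … Υ vtx b κe K = E^{(K+1)}(G; {y_{b_υ}})` — King's external lines from the vertices `vtx υ` to the unit sites `b_υ`
(kinds `κe υ`), `K + 1` coarse scales, torus `2L^{e_M}`. [cite: King1986, Prop. 3.6 (3.56) p.662, Prop. 3.8 (3.71) p.664] -/
def kingLegSeq (a msq : ℝ) (eM nn m : ℕ) (src tgt : Fin m → Fin (nn + 1)) (κ : Fin m → Option (Fin (d + 1))) (Υ : Type) [Fintype Υ]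
    (vtx : Υ → Fin (nn + 1)) (b : Υ → Tor (kingVol L (jvSucc (d := d) eM 0))) (κe : Υ → Option (Fin (d + 1))) (K : ℕ) : ℝ :=
  haveI := kingVol_neZero L (jvSucc (d := d) eM K)
  graphValLS ((((L : ℝ) ^ (K + 1))⁻¹) ^ (d + 1)) src tgt (fun ℓ => kingGLine L (kingVol L (jvSucc (d := d) eM K)) a msq (K + 1) (κ ℓ))
    vtx (fun υ => kingExtLo L a msq (jvSucc (d := d) eM K) (b υ) (κe υ))

/-- ★ **CONSECUTIVE DIFFERENCES: GEOMETRIC IN `K`, WITH DECAY IN EVERY PAIR OF LEGS**: with part Α-g's `(A, γ, δ)` (`king_prop36_extLegs_treeDecay_collected`), under p. 664's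
sentence, for a root leg `υ₀` at the vertex `0`, EVERY pair `υ₁, υ₂` and every `K`:
`|E^{(K+2)}(G; {y_b}) − E^{(K+1)}(G; {y_b})| ≤ ((e^{δ}A^{2m+nn+|Υ|}m!(m+|Υ|+1))·L^{−γ}·e^{−δ|b_{υ₁}−b_{υ₂}|_T})·(L^{−γ})^K` — leg transport (part Β-e), tree decay ≥ pair decay
(part Α-f), base points `≥ |b−b′|_T − 1` apart (part Ψ). [cite: King1986, Prop. 3.6 (3.56) p.662, p.660, p.664, (3.10)–(3.11) p.656] -/
theorem kingLegSeq_succ_sub_le (hLodd : Odd L) (hL : 2 ≤ L) {a : ℝ} (ha : 0 < a) {m0sq : ℝ} (hm0 : 0 ≤ m0sq) :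
    ∃ A γ δ : ℝ, 1 ≤ A ∧ 0 < γ ∧ 0 < δ ∧ ∀ (msq : ℝ), 0 < msq → msq ≤ m0sq → ∀ (eM nn m : ℕ) (src tgt : Fin m → Fin (nn + 1)), (∀ v, LConn src tgt univ 0 v) →
      ∀ (κ : Fin m → Option (Fin (d + 1))), PosSubgraphsBy src tgt 0 ((d + 1 : ℕ) : ℝ) (fun ℓ => lineExp (d + 1) (κ ℓ)) →
      ∀ (Υ : Type) [Fintype Υ] [DecidableEq Υ] (vtx : Υ → Fin (nn + 1)) (υ₀ : Υ), vtx υ₀ = 0 →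
      ∀ (b : Υ → Tor (kingVol L (jvSucc (d := d) eM 0))) (κe : Υ → Option (Fin (d + 1))) (υ₁ υ₂ : Υ) (K : ℕ),
        haveI := kingVol_neZero L (jvSucc (d := d) eM 0)
        |kingLegSeq L a msq eM nn m src tgt κ Υ vtx b κe (K + 1) - kingLegSeq L a msq eM nn m src tgt κ Υ vtx b κe K|
          ≤ ((Real.exp δ * A ^ (2 * m + nn + Fintype.card Υ) * ((m.factorial : ℝ) * (m + Fintype.card Υ + 1))) * (L : ℝ) ^ (-γ)
              * Real.exp (-(δ * tdistT (kingVol L (jvSucc (d := d) eM 0)) (b υ₁) (b υ₂)))) * ((L : ℝ) ^ (-γ)) ^ K := by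
  obtain ⟨A, γ, δ, hA, hγ, hδ, H⟩ := king_prop36_extLegs_treeDecay_collected (d := d) L hLodd hL ha hm0
  refine ⟨A, γ, δ, hA, hγ, hδ, fun msq hm hcap eM nn m src tgt hconn κ hsub Υ _ _ vtx υ₀ hυ₀ b κe υ₁ υ₂ K => ?_⟩
  haveI := kingVol_neZero L (jvSucc (d := d) eM 0)
  set jv : KingVolIndex d := jvSucc (d := d) eM K with hjv
  haveI := kingVol_neZero L jv
  have hL0 : (0 : ℝ) < L := by exact_mod_cast (show 0 < L by omega)
  have hN : (0 : ℝ) < (L : ℝ) ^ jv.K := pow_pos hL0 _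
  have key := H msq hm hcap jv 1 le_rfl nn m src tgt hconn κ hsub Υ vtx υ₀ hυ₀ b κe
  -- the `(K+2)`-term: legs transported
  have hlegs : (fun υ => kingExtLo L a msq (jvSucc (d := d) eM (K + 1)) (b υ) (κe υ)) = fun υ => kingExtHi L a msq jv 1 (b υ) (κe υ) :=
    funext fun υ => funext fun x' => (kingExtHi_jvSucc_eq L a msq eM K (b υ) (κe υ) x').symm
  have hdiff : kingLegSeq L a msq eM nn m src tgt κ Υ vtx b κe (K + 1) - kingLegSeq L a msq eM nn m src tgt κ Υ vtx b κe K
      = graphValLS ((((L : ℝ) ^ (jv.K + 1))⁻¹) ^ (d + 1)) src tgt (fun ℓ => kingGLine L (kingVol L jv) a msq (jv.K + 1) (κ ℓ)) vtx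
            (fun υ => kingExtHi L a msq jv 1 (b υ) (κe υ))
        - graphValLS ((((L : ℝ) ^ jv.K)⁻¹) ^ (d + 1)) src tgt (fun ℓ => kingGLine L (kingVol L jv) a msq jv.K (κ ℓ)) vtx
            (fun υ => kingExtLo L a msq jv (b υ) (κe υ)) := by
    unfold kingLegSeq
    rw [hlegs]
    rfl
  rw [hdiff]
  -- tree decay ⇒ pair decay ⇒ unit-block decay
  have hpair := exp_treeLength_le_exp_pair L jv (fun υ => some (basePt (L ^ jv.K) (kingVol L jv) (b υ))) (υ₁ := υ₁) (υ₂ := υ₂)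
    (y₁ := basePt (L ^ jv.K) (kingVol L jv) (b υ₁)) (y₂ := basePt (L ^ jv.K) (kingVol L jv) (b υ₂)) rfl rfl hδ.le
  have hdist : tdistT (kingVol L jv) (b υ₁) (b υ₂)
      ≤ kingDist L jv (basePt (L ^ jv.K) (kingVol L jv) (b υ₁)) (basePt (L ^ jv.K) (kingVol L jv) (b υ₂)) + 1 := by
    have h := mul_tdistT_blockOf_le (L ^ jv.K) (kingVol L jv) (basePt (L ^ jv.K) (kingVol L jv) (b υ₁)) (basePt (L ^ jv.K) (kingVol L jv) (b υ₂))
    rw [blockOf_basePt, blockOf_basePt] at h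
    push_cast at h
    unfold kingDist
    rw [← sub_le_iff_le_add, le_div_iff₀ hN]
    nlinarith
  have hexp : Real.exp (-(δ * kingDist L jv (basePt (L ^ jv.K) (kingVol L jv) (b υ₁)) (basePt (L ^ jv.K) (kingVol L jv) (b υ₂))))
      ≤ Real.exp δ * Real.exp (-(δ * tdistT (kingVol L jv) (b υ₁) (b υ₂))) := by
    rw [← Real.exp_add]
    exact Real.exp_le_exp.2 (by nlinarith [mul_le_mul_of_nonneg_left hdist hδ.le])
  have hpow : (L : ℝ) ^ (-(γ * (jv.K : ℕ))) = (L : ℝ) ^ (-γ) * ((L : ℝ) ^ (-γ)) ^ K := by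
    rw [show (-(γ * (jv.K : ℕ)) : ℝ) = (-γ) * ((K + 1 : ℕ) : ℝ) from by simp only [hjv, jvSucc]; ring,
      Real.rpow_mul (Nat.cast_nonneg L), Real.rpow_natCast, pow_succ, mul_comm]
  have hθ0 : 0 ≤ (L : ℝ) ^ (-(γ * (jv.K : ℕ))) := Real.rpow_nonneg hL0.le _
  have hC0 : 0 ≤ A ^ (2 * m + nn + Fintype.card Υ) * ((m.factorial : ℝ) * (m + Fintype.card Υ + 1)) := by
    have := zero_le_one.trans hA; positivity
  rw [show (tdistT (kingVol L (jvSucc (d := d) eM 0)) (b υ₁) (b υ₂) : ℝ) = tdistT (kingVol L jv) (b υ₁) (b υ₂) from rfl]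
  calc _ ≤ _ := key
    _ ≤ (Real.exp δ * Real.exp (-(δ * tdistT (kingVol L jv) (b υ₁) (b υ₂)))) * (L : ℝ) ^ (-(γ * (jv.K : ℕ)))
          * (A ^ (2 * m + nn + Fintype.card Υ) * ((m.factorial : ℝ) * (m + Fintype.card Υ + 1))) :=
        mul_le_mul_of_nonneg_right (mul_le_mul_of_nonneg_right (hpair.trans hexp) hθ0) hC0
    _ = _ := by rw [hpow]; ring

/-- ★ **A UNIFORM SIZE WITH DECAY IN EVERY PAIR OF LEGS**: with part Α-l's `(C₁, C₂, Q, δ′)` (`king_graph_size_extLegs_treeDecay_subgraphs`), under p. 664's sentence, for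
EVERY pair `υ₁, υ₂` and every `K`: `|E^{(K+1)}(G; {y_b})| ≤ ((Q·c368 δ′)·C₁^m C₂^{nn}·(Σ_π degConst)·Q^{|Υ|−1})·e^{δ′}·e^{−δ′|b_{υ₁}−b_{υ₂}|_T}` — (3.38)'s tree decay read
pairwise. [cite: King1986, Thm 3.5 (3.38) p.660, Thm 3.3 (3.6) p.656 (shape), p.664] -/
theorem kingLegSeq_abs_le (hLodd : Odd L) (hL : 2 ≤ L) {a : ℝ} (ha : 0 < a) {m0sq : ℝ} (hm0 : 0 ≤ m0sq) :
    ∃ C₁ C₂ Q δ : ℝ, 0 < C₁ ∧ 0 < C₂ ∧ 0 < Q ∧ 0 < δ ∧ ∀ (msq : ℝ), 0 < msq → msq ≤ m0sq →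
      ∀ (eM nn m : ℕ) (src tgt : Fin m → Fin (nn + 1)), (∀ v, LConn src tgt univ 0 v) →
      ∀ (κ : Fin m → Option (Fin (d + 1))), PosSubgraphsBy src tgt 0 ((d + 1 : ℕ) : ℝ) (fun ℓ => lineExp (d + 1) (κ ℓ)) →
      ∀ (Υ : Type) [Fintype Υ] [DecidableEq Υ] (vtx : Υ → Fin (nn + 1)) (υ₀ : Υ), vtx υ₀ = 0 →
      ∀ (b : Υ → Tor (kingVol L (jvSucc (d := d) eM 0))) (κe : Υ → Option (Fin (d + 1))) (υ₁ υ₂ : Υ) (K : ℕ),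
        haveI := kingVol_neZero L (jvSucc (d := d) eM 0)
        |kingLegSeq L a msq eM nn m src tgt κ Υ vtx b κe K|
          ≤ ((Q * c368 d δ) * (C₁ ^ m * C₂ ^ nn
                * (∑ π : Equiv.Perm (Fin m), degConst L (kingDegList src tgt ((d + 1 : ℕ) : ℝ) (fun ℓ => lineExp (d + 1) (κ ℓ)) π))
                * Q ^ (Fintype.card Υ - 1)))
              * (Real.exp δ * Real.exp (-(δ * tdistT (kingVol L (jvSucc (d := d) eM 0)) (b υ₁) (b υ₂)))) := by
  obtain ⟨C₁, C₂, Q, δ, hC₁, hC₂, hQ, hδ, H⟩ := king_graph_size_extLegs_treeDecay_subgraphs (d := d) L hLodd hL ha hm0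
  refine ⟨C₁, C₂, Q, δ, hC₁, hC₂, hQ, hδ, fun msq hm hcap eM nn m src tgt hconn κ hsub Υ _ _ vtx υ₀ hυ₀ b κe υ₁ υ₂ K => ?_⟩
  haveI := kingVol_neZero L (jvSucc (d := d) eM 0)
  set jv : KingVolIndex d := jvSucc (d := d) eM K with hjv
  haveI := kingVol_neZero L jv
  have hL0 : (0 : ℝ) < L := by exact_mod_cast (show 0 < L by omega)
  have hN : (0 : ℝ) < (L : ℝ) ^ jv.K := pow_pos hL0 _
  have key := H msq hm hcap jv nn m src tgt hconn κ hsub Υ vtx υ₀ hυ₀ b κe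
  have hprod : ∏ _υ ∈ (univ : Finset Υ).erase υ₀, Q = Q ^ (Fintype.card Υ - 1) := by
    rw [prod_const, card_erase_of_mem (mem_univ _), card_univ]
  rw [hprod] at key
  have hpair := exp_treeLength_le_exp_pair L jv (fun υ => some (basePt (L ^ jv.K) (kingVol L jv) (b υ))) (υ₁ := υ₁) (υ₂ := υ₂)
    (y₁ := basePt (L ^ jv.K) (kingVol L jv) (b υ₁)) (y₂ := basePt (L ^ jv.K) (kingVol L jv) (b υ₂)) rfl rfl hδ.le
  have hdist : tdistT (kingVol L jv) (b υ₁) (b υ₂)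
      ≤ kingDist L jv (basePt (L ^ jv.K) (kingVol L jv) (b υ₁)) (basePt (L ^ jv.K) (kingVol L jv) (b υ₂)) + 1 := by
    have h := mul_tdistT_blockOf_le (L ^ jv.K) (kingVol L jv) (basePt (L ^ jv.K) (kingVol L jv) (b υ₁)) (basePt (L ^ jv.K) (kingVol L jv) (b υ₂))
    rw [blockOf_basePt, blockOf_basePt] at h
    push_cast at h
    unfold kingDist
    rw [← sub_le_iff_le_add, le_div_iff₀ hN]
    nlinarith
  have hexp : Real.exp (-(δ * kingDist L jv (basePt (L ^ jv.K) (kingVol L jv) (b υ₁)) (basePt (L ^ jv.K) (kingVol L jv) (b υ₂))))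
      ≤ Real.exp δ * Real.exp (-(δ * tdistT (kingVol L jv) (b υ₁) (b υ₂))) := by
    rw [← Real.exp_add]
    exact Real.exp_le_exp.2 (by nlinarith [mul_le_mul_of_nonneg_left hdist hδ.le])
  have hS0 : 0 ≤ (Q * c368 d δ) * (C₁ ^ m * C₂ ^ nn
      * (∑ π : Equiv.Perm (Fin m), degConst L (kingDegList src tgt ((d + 1 : ℕ) : ℝ) (fun ℓ => lineExp (d + 1) (κ ℓ)) π)) * Q ^ (Fintype.card Υ - 1)) := by
    have hdeg : 0 ≤ ∑ π : Equiv.Perm (Fin m), degConst L (kingDegList src tgt ((d + 1 : ℕ) : ℝ) (fun ℓ => lineExp (d + 1) (κ ℓ)) π) :=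
      sum_nonneg fun π _ => zero_le_one.trans (one_le_degConst L hL
        (posDegrees_of_posDegreesBy le_rfl (posDegreesBy_kingDegList_of_posSubgraphsBy le_rfl hsub π)))
    have := c368_pos d hδ
    positivity
  rw [show (tdistT (kingVol L (jvSucc (d := d) eM 0)) (b υ₁) (b υ₂) : ℝ) = tdistT (kingVol L jv) (b υ₁) (b υ₂) from rfl]
  unfold kingLegSeq
  calc _ ≤ _ := key
    _ ≤ _ := by rw [mul_comm]; exact mul_le_mul_of_nonneg_left (hpair.trans hexp) hS0

end Objects

/-! ## §2 The continuum n-point kernel: existence with rate and pair decay; exponential clustering of the limit -/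

section Limit

/-- ★★★ **THE CONTINUUM n-POINT KERNEL OF A CONNECTED DIAGRAM EXISTS, WITH (3.56)'s RATE AND PAIR DECAY AGAINST THE LIMIT — THEOREM 2.1 (i)'s «∃ lim_{κ→∞}» FOR
`E^{(K)}(G; {y_{b_υ}})`, BY NAME AT `A = 0`.**  For odd `L ≥ 3`, `a > 0`, `m₀² ≥ 0` there are `A ≥ 1`, `γ, δ > 0` such that for every mass `0 < m² ≤ m₀²`, volume exponent
`e_M`, CONNECTED numbered graph under p. 664's sentence, family `Υ` of legs (root `υ₀` at the vertex `0`) at unit sites `b_υ` there is `E^{(∞)}(G; {b_υ}) ∈ ℝ` with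
`E^{(K+1)}(G; {y_b}) → E^{(∞)}` and, FOR EVERY PAIR `υ₁, υ₂` and every `K`,
`|E^{(K+1)}(G; {y_b}) − E^{(∞)}(G; {b})| ≤ ((e^{δ}A^{2m+nn+|Υ|}m!(m+|Υ|+1))·L^{−γ}·e^{−δ|b_{υ₁}−b_{υ₂}|_T})·(L^{−γ})^K∕(1 − L^{−γ})` — §1 and Mathlib's
`cauchySeq_of_le_geometric` ∕ `dist_le_of_le_geometric_of_tendsto` (one limit, the pair-dependent constants applied to it).
[cite: King1986, Thm 2.1 (i) (2.22) p.654, (3.13) p.657, Prop. 3.6 (3.56) p.662, p.660] -/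
theorem king_graphLegs_continuumLimit (hLodd : Odd L) (hL : 2 ≤ L) {a : ℝ} (ha : 0 < a) {m0sq : ℝ} (hm0 : 0 ≤ m0sq) :
    ∃ A γ δ : ℝ, 1 ≤ A ∧ 0 < γ ∧ 0 < δ ∧ ∀ (msq : ℝ), 0 < msq → msq ≤ m0sq → ∀ (eM nn m : ℕ) (src tgt : Fin m → Fin (nn + 1)), (∀ v, LConn src tgt univ 0 v) →
      ∀ (κ : Fin m → Option (Fin (d + 1))), PosSubgraphsBy src tgt 0 ((d + 1 : ℕ) : ℝ) (fun ℓ => lineExp (d + 1) (κ ℓ)) →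
      ∀ (Υ : Type) [Fintype Υ] [DecidableEq Υ] (vtx : Υ → Fin (nn + 1)) (υ₀ : Υ), vtx υ₀ = 0 →
      ∀ (b : Υ → Tor (kingVol L (jvSucc (d := d) eM 0))) (κe : Υ → Option (Fin (d + 1))),
      ∃ Einf : ℝ, Tendsto (kingLegSeq L a msq eM nn m src tgt κ Υ vtx b κe) atTop (𝓝 Einf) ∧
        ∀ (υ₁ υ₂ : Υ) (K : ℕ),
          haveI := kingVol_neZero L (jvSucc (d := d) eM 0)
          |kingLegSeq L a msq eM nn m src tgt κ Υ vtx b κe K - Einf|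
            ≤ ((Real.exp δ * A ^ (2 * m + nn + Fintype.card Υ) * ((m.factorial : ℝ) * (m + Fintype.card Υ + 1))) * (L : ℝ) ^ (-γ)
                * Real.exp (-(δ * tdistT (kingVol L (jvSucc (d := d) eM 0)) (b υ₁) (b υ₂)))) * ((L : ℝ) ^ (-γ)) ^ K / (1 - (L : ℝ) ^ (-γ)) := by
  obtain ⟨A, γ, δ, hA, hγ, hδ, H⟩ := kingLegSeq_succ_sub_le (d := d) L hLodd hL ha hm0
  refine ⟨A, γ, δ, hA, hγ, hδ, fun msq hm hcap eM nn m src tgt hconn κ hsub Υ _ _ vtx υ₀ hυ₀ b κe => ?_⟩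
  haveI := kingVol_neZero L (jvSucc (d := d) eM 0)
  have hL1r : (1 : ℝ) < L := by exact_mod_cast (show 1 < L by omega)
  have hr1 : (L : ℝ) ^ (-γ) < 1 := Real.rpow_lt_one_of_one_lt_of_neg hL1r (by linarith)
  -- the pair-dependent geometric constants
  set C : Υ → Υ → ℝ := fun υ₁ υ₂ => (Real.exp δ * A ^ (2 * m + nn + Fintype.card Υ) * ((m.factorial : ℝ) * (m + Fintype.card Υ + 1))) * (L : ℝ) ^ (-γ)
      * Real.exp (-(δ * tdistT (kingVol L (jvSucc (d := d) eM 0)) (b υ₁) (b υ₂))) with hC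
  have hdistK : ∀ υ₁ υ₂ K, dist (kingLegSeq L a msq eM nn m src tgt κ Υ vtx b κe K) (kingLegSeq L a msq eM nn m src tgt κ Υ vtx b κe (K + 1))
      ≤ C υ₁ υ₂ * ((L : ℝ) ^ (-γ)) ^ K := fun υ₁ υ₂ K => by
    rw [Real.dist_eq, abs_sub_comm]; exact H msq hm hcap eM nn m src tgt hconn κ hsub Υ vtx υ₀ hυ₀ b κe υ₁ υ₂ K
  obtain ⟨Einf, hlim⟩ := cauchySeq_tendsto_of_complete (cauchySeq_of_le_geometric _ (C υ₀ υ₀) hr1 (hdistK υ₀ υ₀))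
  refine ⟨Einf, hlim, fun υ₁ υ₂ K => ?_⟩
  rw [← Real.dist_eq]
  exact dist_le_of_le_geometric_of_tendsto _ (C υ₁ υ₂) hr1 (hdistK υ₁ υ₂) hlim K

/-- ★★★ **EXPONENTIAL CLUSTERING OF THE CONTINUUM n-POINT KERNEL IN EVERY PAIR OF ITS ARGUMENTS — (3.38)∕(3.6)'s DECAY SHAPE FOR THE LIMIT.**  With part Α-l's
`(C₁, C₂, Q, δ′)`: for every mass, volume exponent, CONNECTED numbered graph under p. 664's sentence, family `Υ` of legs (root at the vertex `0`) at unit sites `b_υ`,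
every limit point `E^{(∞)}` of `E^{(K+1)}(G; {y_b})` and EVERY pair `υ₁, υ₂`:
`|E^{(∞)}(G; {b_υ})| ≤ ((Q·c368 δ′)·C₁^m C₂^{nn}·(Σ_π degConst)·Q^{|Υ|−1})·e^{δ′}·e^{−δ′|b_{υ₁}−b_{υ₂}|_T}` — §1's uniform size and `le_of_tendsto`.
[cite: King1986, Thm 3.5 (3.38) p.660, Thm 3.3 (3.6) p.656 (shape), (3.13) p.657 («the uniform bound … ultra-violet stability»), p.664] -/
theorem king_graphLegs_limit_pairDecay (hLodd : Odd L) (hL : 2 ≤ L) {a : ℝ} (ha : 0 < a) {m0sq : ℝ} (hm0 : 0 ≤ m0sq) :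
    ∃ C₁ C₂ Q δ : ℝ, 0 < C₁ ∧ 0 < C₂ ∧ 0 < Q ∧ 0 < δ ∧ ∀ (msq : ℝ), 0 < msq → msq ≤ m0sq →
      ∀ (eM nn m : ℕ) (src tgt : Fin m → Fin (nn + 1)), (∀ v, LConn src tgt univ 0 v) →
      ∀ (κ : Fin m → Option (Fin (d + 1))), PosSubgraphsBy src tgt 0 ((d + 1 : ℕ) : ℝ) (fun ℓ => lineExp (d + 1) (κ ℓ)) →
      ∀ (Υ : Type) [Fintype Υ] [DecidableEq Υ] (vtx : Υ → Fin (nn + 1)) (υ₀ : Υ), vtx υ₀ = 0 →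
      ∀ (b : Υ → Tor (kingVol L (jvSucc (d := d) eM 0))) (κe : Υ → Option (Fin (d + 1))),
      ∀ Einf : ℝ, Tendsto (kingLegSeq L a msq eM nn m src tgt κ Υ vtx b κe) atTop (𝓝 Einf) →
        ∀ υ₁ υ₂ : Υ,
          haveI := kingVol_neZero L (jvSucc (d := d) eM 0)
          |Einf| ≤ ((Q * c368 d δ) * (C₁ ^ m * C₂ ^ nn
                  * (∑ π : Equiv.Perm (Fin m), degConst L (kingDegList src tgt ((d + 1 : ℕ) : ℝ) (fun ℓ => lineExp (d + 1) (κ ℓ)) π))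
                  * Q ^ (Fintype.card Υ - 1)))
                * (Real.exp δ * Real.exp (-(δ * tdistT (kingVol L (jvSucc (d := d) eM 0)) (b υ₁) (b υ₂)))) := by
  obtain ⟨C₁, C₂, Q, δ, hC₁, hC₂, hQ, hδ, H⟩ := kingLegSeq_abs_le (d := d) L hLodd hL ha hm0
  refine ⟨C₁, C₂, Q, δ, hC₁, hC₂, hQ, hδ, fun msq hm hcap eM nn m src tgt hconn κ hsub Υ _ _ vtx υ₀ hυ₀ b κe Einf hlim υ₁ υ₂ => ?_⟩
  exact le_of_tendsto ((continuous_abs.tendsto Einf).comp hlim)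
    (Eventually.of_forall fun K => H msq hm hcap eM nn m src tgt hconn κ hsub Υ vtx υ₀ hυ₀ b κe υ₁ υ₂ K)

end Limit

/-! ## §3 The hypothesis-free class: connected pseudoforests of `G`-lines, `1 ≤ d ≤ 3` -/

section Pseudoforest

/-- ★★ **THE CONTINUUM n-POINT KERNEL OF EVERY CONNECTED PSEUDOFOREST OF `G`-LINES WITH KING's LEGS EXISTS, WITH RATE AND PAIR DECAY — NO HYPOTHESIS** (`1 ≤ d ≤ 3`).
[cite: King1986, Thm 2.1 (i) (2.22) p.654, Prop. 3.6 (3.56) p.662, p.664] -/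
theorem king_pseudoforestLegs_continuumLimit (hd1 : 1 ≤ d) (hd3 : d ≤ 3) (hLodd : Odd L) (hL : 2 ≤ L) {a : ℝ} (ha : 0 < a)
    {m0sq : ℝ} (hm0 : 0 ≤ m0sq) :
    ∃ A γ δ : ℝ, 1 ≤ A ∧ 0 < γ ∧ 0 < δ ∧ ∀ (msq : ℝ), 0 < msq → msq ≤ m0sq → ∀ (eM nn m : ℕ) (src tgt : Fin m → Fin (nn + 1)), (∀ v, LConn src tgt univ 0 v) →
      (∀ ℓ, src ℓ ≠ tgt ℓ) → (∀ S : Finset (Fin m), S.card ≤ (lineVerts src tgt S).card) →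
      (∀ S : Finset (Fin m), S.card = 2 → 3 ≤ (lineVerts src tgt S).card) →
      ∀ (Υ : Type) [Fintype Υ] [DecidableEq Υ] (vtx : Υ → Fin (nn + 1)) (υ₀ : Υ), vtx υ₀ = 0 →
      ∀ (b : Υ → Tor (kingVol L (jvSucc (d := d) eM 0))) (κe : Υ → Option (Fin (d + 1))),
      ∃ Einf : ℝ, Tendsto (kingLegSeq L a msq eM nn m src tgt (fun _ : Fin m => (none : Option (Fin (d + 1)))) Υ vtx b κe) atTop (𝓝 Einf) ∧
        ∀ (υ₁ υ₂ : Υ) (K : ℕ),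
          haveI := kingVol_neZero L (jvSucc (d := d) eM 0)
          |kingLegSeq L a msq eM nn m src tgt (fun _ : Fin m => (none : Option (Fin (d + 1)))) Υ vtx b κe K - Einf|
            ≤ ((Real.exp δ * A ^ (2 * m + nn + Fintype.card Υ) * ((m.factorial : ℝ) * (m + Fintype.card Υ + 1))) * (L : ℝ) ^ (-γ)
                * Real.exp (-(δ * tdistT (kingVol L (jvSucc (d := d) eM 0)) (b υ₁) (b υ₂)))) * ((L : ℝ) ^ (-γ)) ^ K / (1 - (L : ℝ) ^ (-γ)) := by
  obtain ⟨A, γ, δ, hA, hγ, hδ, H⟩ := king_graphLegs_continuumLimit (d := d) L hLodd hL ha hm0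
  refine ⟨A, γ, δ, hA, hγ, hδ, fun msq hm hcap eM nn m src tgt hconn h1 h2 h3 Υ _ _ vtx υ₀ hυ₀ b κe => ?_⟩
  exact H msq hm hcap eM nn m src tgt hconn _ (posSubgraphsBy_lineExp_pseudoforest hd1 hd3 h1 h2 h3) Υ vtx υ₀ hυ₀ b κe

/-- ★★ **EXPONENTIAL CLUSTERING OF THE CONTINUUM KERNEL OF EVERY CONNECTED PSEUDOFOREST WITH KING's LEGS — NO HYPOTHESIS** (`1 ≤ d ≤ 3`).
[cite: King1986, Thm 3.5 (3.38) p.660, Thm 3.3 (3.6) p.656 (shape), p.664] -/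
theorem king_pseudoforestLegs_limit_pairDecay (hd1 : 1 ≤ d) (hd3 : d ≤ 3) (hLodd : Odd L) (hL : 2 ≤ L) {a : ℝ} (ha : 0 < a)
    {m0sq : ℝ} (hm0 : 0 ≤ m0sq) :
    ∃ C₁ C₂ Q δ : ℝ, 0 < C₁ ∧ 0 < C₂ ∧ 0 < Q ∧ 0 < δ ∧ ∀ (msq : ℝ), 0 < msq → msq ≤ m0sq →
      ∀ (eM nn m : ℕ) (src tgt : Fin m → Fin (nn + 1)), (∀ v, LConn src tgt univ 0 v) →
      (∀ ℓ, src ℓ ≠ tgt ℓ) → (∀ S : Finset (Fin m), S.card ≤ (lineVerts src tgt S).card) →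
      (∀ S : Finset (Fin m), S.card = 2 → 3 ≤ (lineVerts src tgt S).card) →
      ∀ (Υ : Type) [Fintype Υ] [DecidableEq Υ] (vtx : Υ → Fin (nn + 1)) (υ₀ : Υ), vtx υ₀ = 0 →
      ∀ (b : Υ → Tor (kingVol L (jvSucc (d := d) eM 0))) (κe : Υ → Option (Fin (d + 1))),
      ∀ Einf : ℝ, Tendsto (kingLegSeq L a msq eM nn m src tgt (fun _ : Fin m => (none : Option (Fin (d + 1)))) Υ vtx b κe) atTop (𝓝 Einf) →
        ∀ υ₁ υ₂ : Υ,
          haveI := kingVol_neZero L (jvSucc (d := d) eM 0)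
          |Einf| ≤ ((Q * c368 d δ) * (C₁ ^ m * C₂ ^ nn
                  * (∑ π : Equiv.Perm (Fin m), degConst L (kingDegList src tgt ((d + 1 : ℕ) : ℝ)
                      (fun ℓ => lineExp (d + 1) ((fun _ : Fin m => (none : Option (Fin (d + 1)))) ℓ)) π))
                  * Q ^ (Fintype.card Υ - 1)))
                * (Real.exp δ * Real.exp (-(δ * tdistT (kingVol L (jvSucc (d := d) eM 0)) (b υ₁) (b υ₂)))) := by
  obtain ⟨C₁, C₂, Q, δ, hC₁, hC₂, hQ, hδ, H⟩ := king_graphLegs_limit_pairDecay (d := d) L hLodd hL ha hm0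
  refine ⟨C₁, C₂, Q, δ, hC₁, hC₂, hQ, hδ, fun msq hm hcap eM nn m src tgt hconn h1 h2 h3 Υ _ _ vtx υ₀ hυ₀ b κe Einf hlim υ₁ υ₂ => ?_⟩
  exact H msq hm hcap eM nn m src tgt hconn _ (posSubgraphsBy_lineExp_pseudoforest hd1 hd3 h1 h2 h3) Υ vtx υ₀ hυ₀ b κe Einf hlim υ₁ υ₂

end Pseudoforest

end Summit.QuantumFields.YangMills.BalabanUVNodes.N15KingModelRung.Curved

end
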